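import Summits.QuantumFields.YangMills.Theorems.BalabanUVNodesN19JacksonMeanSecondOrder

/-!
# YM-DAG node N19 (= NE7 proper) — JACKSON SMOOTHING OF A `C^{1,1}` PERIODIC FUNCTION: MODULE 151's INPUT WITH `B₂ = Lip(f′)`, NO STEKLOV STEP
# (`(J_L f)′ = J_L(f′)` by parts on the period; modes `≤ 2L`, mass `≤ π⁴ML∕8`, `|g − f| ≤ Lip(f′)·π⁶∕(8L²)`)

Cell `pub-ymgap`, HUMAN RULING D-0062 (Track A) ∕ D-0149, R141 (C) seat `pub-ymgap-dag-n19-e` (s3 = ALTERNATIVE CURRENCY), generation g35,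
module 2 (lineage module 186).  Route `Summits/QuantumFields/YangMills/Theses/BalabanUVNodes.lean`, cluster item K3⁸ «SpineGivenEndpointR13SepCoPHV»
(stmt-QuantumFields-27366); filed `--supports` that item `--as helper` (it proves no registered stub).  COUNT-NEUTRAL: [folklore]∕[bookkeeping] over
Mathlib (`intervalIntegral.integral_mul_deriv_eq_deriv_mul`, `HasDerivAt.comp_add_const`, `HasDerivAt.unique`) and, BY NAME, module 138 `…N19FejerMean`
(`abs_fourierCoeff_le`), module 165 `…N19JacksonKernelMean` (`jacksonMean_eq_trigSum`, `le_integral_fejerKernel_sq`), module 185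
`…N19JacksonMeanSecondOrder` (`abs_jacksonMean_le`, `abs_jacksonMean_taylor_le`, `abs_jacksonMean_sub_le_of_deriv`, `continuous_of_abs_sub_le`); no laws,
no scheme object, no Theses import; NOT a discharge claim.

CONTENT.  §1 by parts on the period for a `2π`-periodic `f` with continuous derivative `f₁` and `k ∈ ℕ`: `∫f₁cos(k·) = k∫f sin(k·)`,
`∫f₁sin(k·) = −k∫f cos(k·)` (`integral_deriv_mul_cos∕sin`; the boundary terms die by periodicity ∕ `sin(kπ) = 0`), and `f₁` is periodic
(`periodic_deriv_of_periodic`).  §2 ★★ `exists_trigLink_near_periodicC11_jackson`: module 166's package (`exists_trigLink_near_periodicLipschitz_jackson`)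
for `C^{1,1}` data — the Jackson mean `g = J_L f` written as a trigonometric sum over `((range L)²)² × Bool` (modes `≤ 2L`, mass `≤ π⁴ML∕8`), its FORMAL
derivative `g₁ = J_L(f₁)` (§1), hence `|g(u) − g(a) − g₁(a)(u − a)| ≤ Λ′(u − a)²` with `Λ′ = Lip(f′)` (NOT `Λ∕δ`), `|g₁| ≤ sup|f₁|`, and the SECOND-ORDER
error `|g − f| ≤ Λ′π⁶∕(8L²)`.  Lineage 187 transports it to a `C²` link on `[0, d]`; lineage 188 runs module 176's budget: `C²` links are LOG-FREE.

HONEST FRAMING (binding).  Elementary and [folklore] (Jackson 1911; Butzer–Nessel 1971 §1.5); NO consumer in the DAG today (degree model of the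
seat's own currency map); nothing of Bałaban's instantiated; NE7 NOT PRINTED, NOT proved; N19 NOT discharged; count-neutral.  One finite `T⁴`
programme at fixed `ε`; nothing continuum ∕ `ℝ⁴` ∕ OS ∕ mass-gap ∕ Clay.  0 `def` ∕ 0 `sorry`.
-/

noncomputable section

open Finset MeasureTheory intervalIntegral
open scoped Real

namespace Summit.QuantumFields.YangMills.Theorems.BalabanUVNodesN19JacksonSmoothingC11

open Literature.Probability.LatticeModels (fejerKernel)
open Summit.QuantumFields.YangMills.Theorems.BalabanUVNodesN19FejerMean (abs_fourierCoeff_le)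
open Summit.QuantumFields.YangMills.Theorems.BalabanUVNodesN19JacksonKernelMean (jacksonMean_eq_trigSum le_integral_fejerKernel_sq)
open Summit.QuantumFields.YangMills.Theorems.BalabanUVNodesN19JacksonMeanSecondOrder
  (abs_jacksonMean_le abs_jacksonMean_taylor_le abs_jacksonMean_sub_le_of_deriv continuous_of_abs_sub_le)

/-! ## §1 Integration by parts on the period [folklore] -/

/-- **INTEGRATION BY PARTS ON THE PERIOD, cosine**: for `f` `2π`-periodic with `f′ = f₁` continuous and `k ∈ ℕ`,
`∫_{−π}^{π} f₁(w)cos(kw) dw = k·∫_{−π}^{π} f(w)sin(kw) dw` (the boundary term `cos(kπ)(f(π) − f(−π))` vanishes). [folklore] -/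
theorem integral_deriv_mul_cos {f f₁ : ℝ → ℝ} (hper : Function.Periodic f (2 * π)) (hder : ∀ θ, HasDerivAt f (f₁ θ) θ)
    (hf₁c : Continuous f₁) (k : ℕ) :
    ∫ w in (-π)..π, f₁ w * Real.cos (k * w) = k * ∫ w in (-π)..π, f w * Real.sin (k * w) := by
  have hu : ∀ x ∈ Set.uIcc (-π) π, HasDerivAt (fun w => Real.cos (k * w)) (-(k * Real.sin (k * x))) x := by
    intro x _
    have h1 : HasDerivAt (fun w => (k : ℝ) * w) (k : ℝ) x := by simpa using (hasDerivAt_id x).const_mul (k : ℝ)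
    exact h1.cos.congr_deriv (by ring)
  have hIu' : IntervalIntegrable (fun x => -((k : ℝ) * Real.sin (k * x))) volume (-π) π :=
    (by fun_prop : Continuous fun x => -((k : ℝ) * Real.sin (k * x))).intervalIntegrable _ _
  have key := intervalIntegral.integral_mul_deriv_eq_deriv_mul hu (fun x _ => hder x) hIu' (hf₁c.intervalIntegrable _ _)
  have hππ : f π = f (-π) := by have := hper (-π); rw [show -π + 2 * π = π by ring] at this; exact this
  have hcos : Real.cos (k * π) = Real.cos (k * (-π)) := by rw [mul_neg, Real.cos_neg]
  have e1 : ∫ w in (-π)..π, f₁ w * Real.cos (k * w) = ∫ w in (-π)..π, Real.cos (k * w) * f₁ w :=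
    intervalIntegral.integral_congr fun w _ => by ring
  have e2 : ∫ w in (-π)..π, -(k * Real.sin (k * w)) * f w = -(k * ∫ w in (-π)..π, f w * Real.sin (k * w)) := by
    rw [← intervalIntegral.integral_const_mul, ← intervalIntegral.integral_neg]
    exact intervalIntegral.integral_congr fun w _ => by ring
  rw [e1, key, e2, hππ, hcos]
  ring

/-- **INTEGRATION BY PARTS ON THE PERIOD, sine**: `∫_{−π}^{π} f₁(w)sin(kw) dw = −k·∫_{−π}^{π} f(w)cos(kw) dw` (`sin(kπ) = 0`). [folklore] -/
theorem integral_deriv_mul_sin {f f₁ : ℝ → ℝ} (hder : ∀ θ, HasDerivAt f (f₁ θ) θ) (hf₁c : Continuous f₁) (k : ℕ) :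
    ∫ w in (-π)..π, f₁ w * Real.sin (k * w) = -(k * ∫ w in (-π)..π, f w * Real.cos (k * w)) := by
  have hu : ∀ x ∈ Set.uIcc (-π) π, HasDerivAt (fun w => Real.sin (k * w)) (k * Real.cos (k * x)) x := by
    intro x _
    have h1 : HasDerivAt (fun w => (k : ℝ) * w) (k : ℝ) x := by simpa using (hasDerivAt_id x).const_mul (k : ℝ)
    exact h1.sin.congr_deriv (by ring)
  have hIu' : IntervalIntegrable (fun x => (k : ℝ) * Real.cos (k * x)) volume (-π) π :=
    (by fun_prop : Continuous fun x => (k : ℝ) * Real.cos (k * x)).intervalIntegrable _ _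
  have key := intervalIntegral.integral_mul_deriv_eq_deriv_mul hu (fun x _ => hder x) hIu' (hf₁c.intervalIntegrable _ _)
  have hsinπ : Real.sin (k * π) = 0 := Real.sin_nat_mul_pi k
  have hsinπ' : Real.sin (k * (-π)) = 0 := by rw [mul_neg, Real.sin_neg, hsinπ, neg_zero]
  have e1 : ∫ w in (-π)..π, f₁ w * Real.sin (k * w) = ∫ w in (-π)..π, Real.sin (k * w) * f₁ w :=
    intervalIntegral.integral_congr fun w _ => by ring
  have e2 : ∫ w in (-π)..π, k * Real.cos (k * w) * f w = k * ∫ w in (-π)..π, f w * Real.cos (k * w) := by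
    rw [← intervalIntegral.integral_const_mul]
    exact intervalIntegral.integral_congr fun w _ => by ring
  rw [e1, key, e2, hsinπ, hsinπ']
  ring

/-- The derivative of a `2π`-periodic function is `2π`-periodic. [bookkeeping] -/
theorem periodic_deriv_of_periodic {f f₁ : ℝ → ℝ} (hper : Function.Periodic f (2 * π)) (hder : ∀ θ, HasDerivAt f (f₁ θ) θ) :
    Function.Periodic f₁ (2 * π) := by
  intro θ
  have h2 : HasDerivAt (fun x => f (x + 2 * π)) (f₁ (θ + 2 * π)) θ := (hder (θ + 2 * π)).comp_add_const θ (2 * π)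
  have h3 : (fun x => f (x + 2 * π)) = f := funext hper
  rw [h3] at h2
  exact h2.unique (hder θ)

/-! ## §2 ★★ The Jackson smoothing package for `C^{1,1}` periodic data (module 151's input, no Steklov step) [folklore] -/

/-- ★★ **JACKSON SMOOTHING OF A `C^{1,1}` PERIODIC FUNCTION (second order, log-free, no `δ`).**  Let `f : ℝ → ℝ` be `2π`-periodic with
`f′ = f₁` everywhere, `|f₁(a) − f₁(b)| ≤ Λ′|a − b|`, `|f₁| ≤ Λ`, `|f| ≤ M`, and let `L ≥ 1`.  Then there are `α, β, ω` indexed by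
`p ∈ ((range L × range L) × (range L × range L)) × Bool` (`ω_p ∈ ℕ`, `0 ≤ ω_p ≤ 2L`, `Σ_p(|α_p| + |β_p|) ≤ π⁴ML∕8`) such that the Jackson mean
`g(θ) = Σ_p(α_p cos(ω_pθ) + β_p sin(ω_pθ)) = (1∕Z)∫f(θ − v)f_L(v)²dv` and its formal derivative `g₁(θ) = Σ_p ω_p(β_p cos(ω_pθ) − α_p sin(ω_pθ))`
(`= (1∕Z)∫f₁(θ − v)f_L(v)²dv`, by parts) satisfy `|g(u) − g(a) − g₁(a)(u − a)| ≤ Λ′(u − a)²`, `|g₁| ≤ Λ` and `|g(θ) − f(θ)| ≤ Λ′π⁶∕(8L²)` for all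
reals — module 166's package with the `C^{1,1}` constant of `f` itself and a SECOND-ORDER smoothing error. [folklore] -/
theorem exists_trigLink_near_periodicC11_jackson {f f₁ : ℝ → ℝ} {Λ Λ' M : ℝ} (hper : Function.Periodic f (2 * π))
    (hder : ∀ θ, HasDerivAt f (f₁ θ) θ) (hLip : ∀ a b, |f₁ a - f₁ b| ≤ Λ' * |a - b|) (hΛ : ∀ θ, |f₁ θ| ≤ Λ)
    (hM : ∀ w, |f w| ≤ M) {L : ℕ} (hL : 1 ≤ L) :
    ∃ α β ω : ((ℕ × ℕ) × (ℕ × ℕ)) × Bool → ℝ, (∀ p, 0 ≤ ω p) ∧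
      (∀ p ∈ ((range L ×ˢ range L) ×ˢ (range L ×ˢ range L)) ×ˢ (Finset.univ : Finset Bool), ω p ≤ 2 * L) ∧
      (∑ p ∈ ((range L ×ˢ range L) ×ˢ (range L ×ˢ range L)) ×ˢ (Finset.univ : Finset Bool), (|α p| + |β p|) ≤ π ^ 4 * M * L / 8) ∧
      (∀ u a, |(∑ p ∈ ((range L ×ˢ range L) ×ˢ (range L ×ˢ range L)) ×ˢ (Finset.univ : Finset Bool),
            (α p * Real.cos (ω p * u) + β p * Real.sin (ω p * u))) -
          (∑ p ∈ ((range L ×ˢ range L) ×ˢ (range L ×ˢ range L)) ×ˢ (Finset.univ : Finset Bool),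
            (α p * Real.cos (ω p * a) + β p * Real.sin (ω p * a))) -
          (∑ p ∈ ((range L ×ˢ range L) ×ˢ (range L ×ˢ range L)) ×ˢ (Finset.univ : Finset Bool),
            ω p * (β p * Real.cos (ω p * a) - α p * Real.sin (ω p * a))) * (u - a)| ≤ Λ' * (u - a) ^ 2) ∧
      (∀ a, |∑ p ∈ ((range L ×ˢ range L) ×ˢ (range L ×ˢ range L)) ×ˢ (Finset.univ : Finset Bool),
          ω p * (β p * Real.cos (ω p * a) - α p * Real.sin (ω p * a))| ≤ Λ) ∧
      (∀ θ, |(∑ p ∈ ((range L ×ˢ range L) ×ˢ (range L ×ˢ range L)) ×ˢ (Finset.univ : Finset Bool),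
          (α p * Real.cos (ω p * θ) + β p * Real.sin (ω p * θ))) - f θ| ≤ Λ' * π ^ 6 / (8 * L ^ 2)) := by
  have hπ := Real.pi_pos
  have hLr : (0 : ℝ) < L := by exact_mod_cast hL
  have hM0 : 0 ≤ M := (abs_nonneg _).trans (hM 0)
  have hfc : Continuous f := continuous_iff_continuousAt.2 fun θ => (hder θ).continuousAt
  have hf₁c : Continuous f₁ := continuous_of_abs_sub_le hLip
  have hper₁ : Function.Periodic f₁ (2 * π) := periodic_deriv_of_periodic hper hder
  set Z : ℝ := ∫ v in (-π)..π, fejerKernel L v ^ 2 with hZ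
  have hZlow : 32 * L / π ^ 3 ≤ Z := le_integral_fejerKernel_sq hL
  have hZ0 : 0 < Z := lt_of_lt_of_le (by positivity) hZlow
  -- the two modes of a quadruple
  set kp : (ℕ × ℕ) × (ℕ × ℕ) → ℕ := fun q => ((q.1.1 : ℤ) - q.1.2).natAbs + ((q.2.1 : ℤ) - q.2.2).natAbs with hkp
  set km : (ℕ × ℕ) × (ℕ × ℕ) → ℕ := fun q => ((((q.1.1 : ℤ) - q.1.2).natAbs : ℤ) - ((q.2.1 : ℤ) - q.2.2).natAbs).natAbs with hkm
  set ω : ((ℕ × ℕ) × (ℕ × ℕ)) × Bool → ℝ := fun p => if p.2 then (kp p.1 : ℝ) else (km p.1 : ℝ) with hω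
  set a : ((ℕ × ℕ) × (ℕ × ℕ)) × Bool → ℝ := fun p => (1 / (2 * L ^ 2 * Z)) * ∫ w in (-π)..π, f w * Real.cos (ω p * w) with ha
  set b : ((ℕ × ℕ) × (ℕ × ℕ)) × Bool → ℝ := fun p => (1 / (2 * L ^ 2 * Z)) * ∫ w in (-π)..π, f w * Real.sin (ω p * w) with hb
  set Q : Finset ((ℕ × ℕ) × (ℕ × ℕ)) := (range L ×ˢ range L) ×ˢ (range L ×ˢ range L) with hQ
  set P : Finset (((ℕ × ℕ) × (ℕ × ℕ)) × Bool) := Q ×ˢ (Finset.univ : Finset Bool) with hP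
  have hωt : ∀ q, ω (q, true) = (kp q : ℝ) := fun q => by simp [hω]
  have hωf : ∀ q, ω (q, false) = (km q : ℝ) := fun q => by simp [hω]
  -- the Jackson mean of `f` as a sum over `P`
  have hT : ∀ θ, (1 / Z) * ∫ v in (-π)..π, f (θ - v) * fejerKernel L v ^ 2 =
      ∑ p ∈ P, (a p * Real.cos (ω p * θ) + b p * Real.sin (ω p * θ)) := by
    intro θ
    rw [jacksonMean_eq_trigSum hfc hper L Z θ, hP, Finset.sum_product (s := Q) (t := (Finset.univ : Finset Bool))]
    refine Finset.sum_congr rfl fun q _ => ?_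
    rw [Fintype.sum_bool]
    simp only [ha, hb, hωt, hωf, hkp, hkm]
    ring
  -- the Jackson mean of `f₁` = the formal derivative (integration by parts)
  have hT₁ : ∀ θ, (1 / Z) * ∫ v in (-π)..π, f₁ (θ - v) * fejerKernel L v ^ 2 =
      ∑ p ∈ P, ω p * (b p * Real.cos (ω p * θ) - a p * Real.sin (ω p * θ)) := by
    intro θ
    rw [jacksonMean_eq_trigSum hf₁c hper₁ L Z θ, hP, Finset.sum_product (s := Q) (t := (Finset.univ : Finset Bool))]
    refine Finset.sum_congr rfl fun q _ => ?_
    rw [Fintype.sum_bool]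
    simp only [ha, hb, hωt, hωf, hkp, hkm, integral_deriv_mul_cos hper hder hf₁c, integral_deriv_mul_sin hder hf₁c]
    ring
  have hω0 : ∀ p, 0 ≤ ω p := by
    intro p; rw [hω]; show 0 ≤ (if p.2 then (kp p.1 : ℝ) else (km p.1 : ℝ)); split_ifs <;> exact Nat.cast_nonneg _
  refine ⟨a, b, ω, hω0, ?_, ?_, ?_, ?_, ?_⟩
  · -- frequencies `≤ 2L`
    intro p hp
    rw [hP, Finset.mem_product, hQ, Finset.mem_product, Finset.mem_product, Finset.mem_product, Finset.mem_range, Finset.mem_range,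
      Finset.mem_range, Finset.mem_range] at hp
    obtain ⟨⟨⟨h11, h12⟩, h21, h22⟩, -⟩ := hp
    have hkp' : kp p.1 ≤ 2 * L := by rw [hkp]; show ((p.1.1.1 : ℤ) - p.1.1.2).natAbs + ((p.1.2.1 : ℤ) - p.1.2.2).natAbs ≤ 2 * L; omega
    have hkm' : km p.1 ≤ 2 * L := by
      rw [hkm]; show ((((p.1.1.1 : ℤ) - p.1.1.2).natAbs : ℤ) - ((p.1.2.1 : ℤ) - p.1.2.2).natAbs).natAbs ≤ 2 * L; omega
    rw [hω]
    show (if p.2 then (kp p.1 : ℝ) else (km p.1 : ℝ)) ≤ 2 * L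
    split_ifs
    · exact_mod_cast hkp'
    · exact_mod_cast hkm'
  · -- mass
    have hc0 : (0 : ℝ) < 1 / (2 * L ^ 2 * Z) := by positivity
    have hcoefZ : 1 / (2 * L ^ 2 * Z) * (2 * π * M) ≤ π ^ 4 * M / (32 * L ^ 3) := by
      have h1 : 1 / (2 * L ^ 2 * Z) ≤ 1 / (2 * L ^ 2 * (32 * L / π ^ 3)) :=
        one_div_le_one_div_of_le (by positivity) (mul_le_mul_of_nonneg_left hZlow (by positivity))
      calc 1 / (2 * L ^ 2 * Z) * (2 * π * M) ≤ 1 / (2 * L ^ 2 * (32 * L / π ^ 3)) * (2 * π * M) :=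
            mul_le_mul_of_nonneg_right h1 (by positivity)
        _ = π ^ 4 * M / (32 * L ^ 3) := by field_simp
    have hcoef : ∀ p ∈ P, |a p| + |b p| ≤ 2 * (π ^ 4 * M / (32 * L ^ 3)) := by
      intro p _
      obtain ⟨hc, hs⟩ := abs_fourierCoeff_le hM (ω p)
      have hc' : |a p| ≤ π ^ 4 * M / (32 * L ^ 3) := by
        rw [ha, abs_mul (1 / (2 * L ^ 2 * Z)) _, abs_of_pos hc0]
        exact (mul_le_mul_of_nonneg_left hc hc0.le).trans hcoefZ
      have hs' : |b p| ≤ π ^ 4 * M / (32 * L ^ 3) := by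
        rw [hb, abs_mul (1 / (2 * L ^ 2 * Z)) _, abs_of_pos hc0]
        exact (mul_le_mul_of_nonneg_left hs hc0.le).trans hcoefZ
      linarith only [hc', hs']
    calc ∑ p ∈ P, (|a p| + |b p|) ≤ ∑ _p ∈ P, 2 * (π ^ 4 * M / (32 * L ^ 3)) := Finset.sum_le_sum hcoef
      _ = (L * L * (L * L) * 2 : ℝ) * (2 * (π ^ 4 * M / (32 * L ^ 3))) := by
          simp only [sum_const, hP, hQ, Finset.card_product, Finset.card_range, Finset.card_univ, Fintype.card_bool, nsmul_eq_mul]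
          push_cast; ring
      _ = π ^ 4 * M * L / 8 := by field_simp; ring
  · -- the `C^{1,1}` constant of `f` passes through the positive kernel
    intro u v
    rw [← hT u, ← hT v, ← hT₁ v]
    exact abs_jacksonMean_taylor_le hder hLip hL u v
  · -- `|g₁| ≤ Λ`
    intro θ
    rw [← hT₁ θ]
    exact abs_jacksonMean_le hΛ hL θ
  · -- second-order smoothing error
    intro θ
    rw [← hT θ]
    exact abs_jacksonMean_sub_le_of_deriv hder hLip hL θ

end Summit.QuantumFields.YangMills.Theorems.BalabanUVNodesN19JacksonSmoothingC11

end
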